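import Literature.AlgebraicGeometry.Limits.LocalizationSmoothSpread
import Literature.AlgebraicGeometry.Limits.LocalizationOpenDescent
import Literature.AlgebraicGeometry.Limits.LocalizationSeparatedSpread
import Mathlib.AlgebraicGeometry.ZariskisMainTheorem
import Mathlib.AlgebraicGeometry.Morphisms.UniversallyOpen
import HarnessLib

/-!
# Finiteness of a morphism spreads out from `Spec A_S` to a stage `Spec A[1/s]`

Topic: `Literature/AlgebraicGeometry/Limits`; sequel of `Limits/LocalizationEtaleSpread`
(`A` a commutative ring, `S ⊆ A` a submonoid, `B = A_S`, `Spec B = lim_s Spec A[1/s]`,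
`LocApprox.Idx S`; for an `A`-algebra `T`, `f_T = (f ▷ Spec T).left : Q ×_A Spec T → P ×_A Spec T`
is the base change of a morphism `f : Q → P` of `A`-schemes).

* `LocApprox.exists_forall_isFinite_whiskerRight` — **finiteness descends through
  `Spec A_S = lim Spec A[1/s]`** (EGA IV₃ 8.10.5 (x); The Stacks Project, Tag 01ZO, for the
  cofiltered system of basic opens): let `f : Q → P` be separated, quasi-compact and locally of
  finite type, `P` quasi-compact over `A`, such that the base change `f_B` is universally closed
  (e.g. finite) and the image of `Q ×_A Spec B → Q` consists of points at which `f` is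
  quasi-finite (e.g. `f_B` étale, via the good locus of `Limits/LocalizationEtaleSpread`). Then
  `f_T` is finite for every model `T` of `A[1/t]`, `t` any multiple of some `s ∈ S`.

The proof given here is not the chart-by-chart one of EGA but runs through **Zariski's Main
Theorem** in Mathlib's form (`Scheme.Hom.exists_isIso_morphismRestrict_toNormalization`, Stacks
03GW): `f = j ≫ ḡ` with `ḡ : X̄ → P` integral (the relative normalization) and `j : Q → X̄` an
isomorphism over an open `O ⊆ X̄` whose preimage is the quasi-finite locus of `f`. The image of
`X̄ ×_A Spec B → X̄` lies in `O`: a point `y` of the image is a specialization of a point of `j(Q)`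
(`j` is quasi-compact and dominant, `Limits/LocalizationSeparatedSpread`), the specialization lifts
along the flat `X̄ ×_A Spec B → X̄` (going down), the lift lies in the image of `j_B`, which is
closed because `j_B` is universally closed (`f_B = j_B ≫ ḡ_B` with `ḡ_B` separated), so `y ∈ j(x)`
with `x` in the image of `Q ×_A Spec B`, a quasi-finite point, i.e. `y ∈ O`. The preimage of `O` in
the limit `X̄ ×_A Spec B = lim_s X̄ ×_A Spec A[1/s]` being everything, so is its preimage in some
stage (Mathlib `exists_map_eq_top`); over such a stage `j_T` is a base change of the isomorphism
`j ∣_ O`, hence `f_T ≅ ḡ_T` is integral and of finite type, i.e. finite.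

Everything is proved; no definitions, no named facts.

## References

* A. Grothendieck, J. Dieudonné, EGA IV₃, Publ. Math. IHÉS 28 (1966), Thm. 8.10.5 (x). [EGAIV3]
* The Stacks Project, Tags 01ZO (finite morphisms and limits), 03GW (Zariski's Main Theorem),
  01K9. [StacksProject]
-/

noncomputable section

universe u

open CategoryTheory CategoryTheory.Limits AlgebraicGeometry TopologicalSpace MonoidalCategory
open Opposite

namespace Literature.AlgebraicGeometry.Limits

namespace LocApprox

open Literature.AlgebraicGeometry.Motives (SchemeOver specOver)

set_option backward.isDefEq.respectTransparency false

section Limit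

variable {A : Type u} [CommRing A] (S : Submonoid A) (B : Type u) [CommRing B] [Algebra A B]
  [IsLocalization S B] {Q P : SchemeOver A} (f : Q ⟶ P)

/-- **Finiteness descends through `Spec A_S = lim Spec A[1/s]`** (EGA IV₃ 8.10.5 (x); Stacks 01ZO,
for the system of basic opens `D(s)`, `s ∈ S`), in the form: let `f : Q → P` be a separated,
quasi-compact morphism locally of finite type of `A`-schemes, `P` quasi-compact over `A`, whose
base change `f_B` to `B = A_S` is universally closed and such that `Q ×_A Spec B → Q` lands in the
quasi-finite locus of `f` (both hold if `f_B` is finite étale, say). Then there is `s ∈ S` such that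
`f_T : Q ×_A Spec T → P ×_A Spec T` is finite for every model `T` of `A[1/t]`, `t` any multiple of
`s`. Proof by Zariski's Main Theorem (Stacks 03GW) and the limit argument, see the module
docstring. [cite: EGAIV3, Thm. 8.10.5 (x)] [cite: StacksProject, Tags 01ZO and 03GW] -/
theorem exists_forall_isFinite_whiskerRight [QuasiCompact P.hom] [QuasiCompact f.left]
    [IsSeparated f.left] [LocallyOfFiniteType f.left]
    (hqf : Set.range (pullback.fst Q.hom (specOver A B).hom) ⊆
      (f.left.quasiFiniteLocus : Set Q.left))
    [UniversallyClosed (f ▷ specOver A B).left] :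
    ∃ s ∈ S, ∀ t : A, s ∣ t → ∀ (T : Type u) [CommRing T] [Algebra A T] [IsLocalization.Away t T],
      IsFinite (f ▷ specOver A T).left := by
  -- Zariski's Main Theorem: `f = j ≫ ḡ`, `ḡ` integral, `j` an isomorphism over `O ⊆ X̄`,
  -- `j ⁻¹ O` the quasi-finite locus
  obtain ⟨O, hO, hO'⟩ := f.left.exists_isIso_morphismRestrict_toNormalization
  set j := f.left.toNormalization with hjdef
  set gb := f.left.fromNormalization with hgbdef
  have hjg : j ≫ gb = f.left := f.left.toNormalization_fromNormalization
  haveI := hO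
  -- the normalization as an `A`-scheme, `j` and `ḡ` as `A`-morphisms
  let Xb : SchemeOver A := Over.mk (gb ≫ P.hom)
  let jo : Q ⟶ Xb := Over.homMk j (show j ≫ gb ≫ P.hom = Q.hom by
    rw [← Category.assoc, hjg]; exact Over.w f)
  let go : Xb ⟶ P := Over.homMk gb rfl
  have hjogo : jo ≫ go = f := Over.OverMorphism.ext (by
    simp only [jo, go, Over.comp_left, Over.homMk_left]; exact hjg)
  haveI : QuasiCompact Xb.hom := inferInstanceAs (QuasiCompact (gb ≫ P.hom))
  -- KEY: the image of `X̄ ×_A Spec B → X̄` lies in `O`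
  have hkey : Set.range (pullback.fst Xb.hom (specOver A B).hom) ⊆
      (O : Set f.left.normalization) := by
    rintro _ ⟨yb, rfl⟩
    set pr := pullback.fst Xb.hom (specOver A B).hom with hprdef
    haveI : Flat (specOver A B).hom := flat_specMap_algebraMap S B
    haveI : Flat pr := MorphismProperty.pullback_fst _ _ inferInstance
    -- `pr yb` is a specialization of a point `j x`, which lifts along the flat `pr`
    have hy : pr yb ∈ closure (Set.range j) := by
      rw [j.denseRange.closure_range]; trivial
    obtain ⟨x, hx⟩ := exists_specializes_of_mem_closure_range j hy
    obtain ⟨yb', hyb', hpr⟩ := Flat.generalizingMap pr hx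
    -- the lift lies in the image of `j_B`, which is closed (`j_B` is universally closed)
    have hrange : Set.range (jo ▷ specOver A B).left = pr ⁻¹' Set.range j :=
      range_whiskerRight_left jo (specOver A B)
    have h1 : yb' ∈ Set.range (jo ▷ specOver A B).left := by
      rw [hrange]; exact ⟨x, hpr.symm⟩
    haveI : IsIntegralHom (go ▷ specOver A B).left :=
      MorphismProperty.of_isPullback (isPullback_whiskerRight_left go (specOver A B)).flip
        (inferInstance : IsIntegralHom gb)
    haveI : UniversallyClosed ((jo ▷ specOver A B).left ≫ (go ▷ specOver A B).left) := by
      rw [← Over.comp_left, ← comp_whiskerRight, hjogo]; infer_instance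
    haveI : UniversallyClosed (jo ▷ specOver A B).left :=
      .of_comp_of_isSeparated _ (go ▷ specOver A B).left
    have hclosed : IsClosed (Set.range (jo ▷ specOver A B).left) :=
      (jo ▷ specOver A B).left.isClosedMap.isClosed_range
    obtain ⟨xb, hxb⟩ : yb ∈ Set.range (jo ▷ specOver A B).left := hyb'.mem_closed hclosed h1
    -- hence `pr yb = j (pr_Q xb)` with `pr_Q xb` a quasi-finite point
    have h3 : pr yb = j (pullback.fst Q.hom (specOver A B).hom xb) := by
      rw [← hxb]
      change ((jo ▷ specOver A B).left ≫ pr) xb = (pullback.fst Q.hom (specOver A B).hom ≫ j) xb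
      rw [hprdef, Over.whiskerRight_left_fst]
      rfl
    have h4 : pullback.fst Q.hom (specOver A B).hom xb ∈ (j ⁻¹ᵁ O).1 := by
      rw [hO']
      exact hqf ⟨xb, rfl⟩
    rw [h3]
    exact h4
  -- the open `O|` of the stage `1`, whose preimage in the limit is everything
  let U : ((prodDiagram S Xb).obj default).Opens :=
    (pullback.fst Xb.hom (Spec.map (CommRingCat.ofHom (algebraMap A (loc S default))))) ⁻¹ᵁ O
  have hU : (prodCone S B Xb).π.app default ⁻¹ᵁ U = ⊤ := by
    change ((prodCone S B Xb).π.app default ≫ pullback.fst _ _) ⁻¹ᵁ O = ⊤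
    rw [prodCone_π_app_fst, preimage_eq_top_iff_range_subset]
    exact hkey
  obtain ⟨s, fs, hs⟩ :=
    exists_map_eq_top (prodDiagram S Xb) (prodCone S B Xb) (isLimitProdCone S B Xb) U hU
  have hs' : Set.range (pullback.fst Xb.hom
      (Spec.map (CommRingCat.ofHom (algebraMap A (loc S s))))) ⊆
        (O : Set f.left.normalization) := by
    rw [← preimage_eq_top_iff_range_subset]
    change (pullback.fst Xb.hom ((baseDiagram S).obj s).hom) ⁻¹ᵁ O = ⊤
    rw [← prodDiagram_map_fst S Xb fs]
    exact hs
  refine ⟨s.val, s.mem, fun t hst T _ _ _ => ?_⟩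
  -- over `D(t)`, `t` a multiple of `s`: `X̄ ×_A Spec T → X̄` lands in `O`
  have hle : (PrimeSpectrum.basicOpen t : Set (PrimeSpectrum A)) ⊆ PrimeSpectrum.basicOpen s.val := by
    obtain ⟨c, rfl⟩ := hst
    exact PrimeSpectrum.basicOpen_mul_le_left s.val c
  set prT := pullback.fst Xb.hom (specOver A T).hom with hprTdef
  have hT : Set.range prT ⊆ (O : Set f.left.normalization) := by
    change Set.range (pullback.fst Xb.hom (Spec.map (CommRingCat.ofHom (algebraMap A T)))) ⊆ _
    rw [range_fst_eq_preimage_basicOpen Xb T t]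
    refine subset_trans (Set.preimage_mono hle) ?_
    rw [← range_fst_eq_preimage_basicOpen Xb (loc S s) s.val]
    exact hs'
  -- `j_T` is an isomorphism: a base change of the isomorphism `j ∣_ O`
  have hsq : IsPullback (pullback.fst Q.hom (specOver A T).hom) (jo ▷ specOver A T).left j prT :=
    (isPullback_whiskerRight_left jo (specOver A T)).flip
  let prT' : (Xb ⊗ specOver A T).left ⟶ O :=
    IsOpenImmersion.lift O.ι prT (by rwa [Scheme.Opens.range_ι])
  have hprT' : prT' ≫ O.ι = prT := IsOpenImmersion.lift_fac _ _ _
  have hsubX : Set.range (pullback.fst Q.hom (specOver A T).hom) ⊆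
      ((j ⁻¹ᵁ O : Q.left.Opens) : Set Q.left) := by
    rintro _ ⟨x, rfl⟩
    show j (pullback.fst Q.hom (specOver A T).hom x) ∈ O
    rw [← Scheme.Hom.comp_apply, hsq.w, Scheme.Hom.comp_apply]
    exact hT ⟨_, rfl⟩
  let tT : (Q ⊗ specOver A T).left ⟶ (j ⁻¹ᵁ O : Q.left.Opens) :=
    IsOpenImmersion.lift (j ⁻¹ᵁ O).ι _ (by rwa [Scheme.Opens.range_ι])
  have htT : tT ≫ (j ⁻¹ᵁ O).ι = pullback.fst Q.hom (specOver A T).hom :=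
    IsOpenImmersion.lift_fac _ _ _
  have hbig : IsPullback (tT ≫ (j ⁻¹ᵁ O).ι) (jo ▷ specOver A T).left j (prT' ≫ O.ι) := by
    rw [htT, hprT']
    exact hsq
  have hcomm : tT ≫ (j ∣_ O) = (jo ▷ specOver A T).left ≫ prT' := by
    rw [← cancel_mono O.ι, Category.assoc, Category.assoc, morphismRestrict_ι, hprT',
      ← Category.assoc, htT]
    exact hsq.w
  have hleft : IsPullback tT (jo ▷ specOver A T).left (j ∣_ O) prT' :=
    IsPullback.of_right hbig hcomm (isPullback_morphismRestrict j O).flip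
  haveI : IsIso (jo ▷ specOver A T).left := hleft.isIso_snd_of_isIso
  -- hence `f_T = j_T ≫ ḡ_T` is integral and locally of finite type, i.e. finite
  haveI : IsIntegralHom (go ▷ specOver A T).left :=
    MorphismProperty.of_isPullback (isPullback_whiskerRight_left go (specOver A T)).flip
      (inferInstance : IsIntegralHom gb)
  have hfac : (f ▷ specOver A T).left = (jo ▷ specOver A T).left ≫ (go ▷ specOver A T).left := by
    rw [← Over.comp_left, ← comp_whiskerRight, hjogo]
  haveI : IsIntegralHom (f ▷ specOver A T).left := by
    rw [hfac]; infer_instance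
  haveI : LocallyOfFiniteType (f ▷ specOver A T).left :=
    MorphismProperty.of_isPullback (isPullback_whiskerRight_left f (specOver A T)).flip
      (inferInstance : LocallyOfFiniteType f.left)
  exact (IsFinite.iff_isIntegralHom_and_locallyOfFiniteType _).mpr ⟨inferInstance, inferInstance⟩

end Limit

end LocApprox

end Literature.AlgebraicGeometry.Limits

end
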